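import Literature.NumberTheory.GaloisRepresentations.LubinTateColemanLogDerivSurjModTwo
import HarnessLib

/-!
# `q = 2`: the division points `W_f^1 = {0, −π}` and the reflection `h ↦ h(X [+] (−π)) = h(−π − X)`

De Shalit, *Iwasawa theory of elliptic curves with complex multiplication* (1987), Ch. I §3.12 builds
Coleman's trace operator from the translates `h(X [+] ω)`, `ω ∈ W_f^1` (tree: `transl`, `colemanTrace`).
When the residue field has TWO elements (`F = ℚ₂`, or any `F` with `|𝓀_F| = 2`) and `f = πX + X²` is the
special Lubin–Tate series, the translates are explicit:

* `eq_zero_or_eq_one_two` — `𝓀_F = {0, 1}`;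
* `coe_ltDivPt_of_ne_zero_two` — **`W_f^1 = {0, −π}`**: the non-zero `π`-division point is `−π ∈ F`
  (`f = X(X + π)`), so `K_π^1 = F`; `mapPt_ltDivPt_one_two` — it is fixed by `G(K_π^{n+1}/F)`;
* `coe_tPt_ltDivPt_two` — **translation by `−π` is the reflection `X [+]_f (−π) = −π − X`** (both sides are
  roots `Z` of `Z² + πZ = f(X)` with constant term `−π ≠ 0`, and `𝒪⟦X⟧` is a domain);
* `transl_ltDivPt_zero`, `transl_ltDivPt_subst_ltSer` — `h(X [+] 0) = h` and, for every `q`,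
  **`(r ∘ f)(X [+] ω) = r ∘ f`** for `ω ∈ W_f^1` (the series in `f` are translation invariant);
* `reflTwo hπ n h` — the series **`h(−π − X) ∈ 𝒪[F]⟦X⟧`** (the translate `h(X [+] (−π))`, descended to
  `𝒪[F]` by Galois), with `map_reflTwo`; it is an `𝒪[F]`-algebra endomorphism (`reflTwo_add`, `reflTwo_mul`,
  `reflTwo_C`, ★ `reflTwo_X : reflTwo X = −X − C π`), an involution (`reflTwo_reflTwo`, from
  `ω₁ [+] ω₁ = ω_{1+1} = 0`), fixes `𝒪[F]⟦f⟧` (`reflTwo_subst_ltSer`), and satisfies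
  ★ **`h − h(−π − X) ≡ 0 (mod π)`** (`sub_reflTwo_mem_coeffIdeal`).

This is the input for the explicit form of the trace operator at `q = 2`, `(𝒮h) ∘ f = h + h(−π − X)`, and
for the rank-two decomposition `𝒪⟦X⟧ = 𝒪⟦f⟧ ⊕ X·𝒪⟦f⟧` (sequel file).  0 sorry, no named facts.

## References

* E. de Shalit, *Iwasawa theory of elliptic curves with complex multiplication* (1987), Ch. I §1.7, §3.12.
  [deShalit1987]
* R. Coleman, *Division values in local fields*, Invent. Math. 53 (1979), Lemma 6. [Coleman1979]
-/

noncomputable section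

open scoped PowerSeries.WithPiTopology

namespace Literature.NumberTheory.GaloisRepresentations

section LocalFieldR2

open GaloisRepresentations.IsNonarchimedeanLocalField LubinTate ValuativeRel

variable (F : Type*) [Field F] [ValuativeRel F] [TopologicalSpace F] [IsNonarchimedeanLocalField F]

attribute [local instance] ltNormUniformSpace ltNormIsUniformAddGroup rk1 nF nE fintypeResidueField

variable {F}
variable {π : 𝒪[F]} (hπ : (valuation F).IsUniformizer (π : F)) (n : ℕ)

/-! ### A residue field with two elements -/

/-- `|𝓀_F| = 2`: every residue is `0` or `1`. [cite: deShalit1987, Ch. I §1.7] -/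
theorem eq_zero_or_eq_one_two (hq : residueFieldCard F = 2) (c : 𝓀[F]) : c = 0 ∨ c = 1 := by
  classical
  by_contra h
  push Not at h
  have hcard : Fintype.card 𝓀[F] = 2 := by rw [← Nat.card_eq_fintype_card]; exact hq
  have h3 : ({0, 1, c} : Finset 𝓀[F]).card ≤ Fintype.card 𝓀[F] := Finset.card_le_univ _
  rw [Finset.card_insert_of_notMem (by simp [h.1.symm]), Finset.card_pair (Ne.symm h.2), hcard] at h3
  omega

/-- `|𝓀_F| = 2`: every non-zero residue is `1`. [cite: deShalit1987, Ch. I §1.7] -/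
theorem eq_one_of_ne_zero_two (hq : residueFieldCard F = 2) {c : 𝓀[F]} (hc : c ≠ 0) : c = 1 :=
  (eq_zero_or_eq_one_two hq c).resolve_left hc

/-! ### The division points of level one: `W_f^1 = {0, −π}` -/

/-- `ω_0 = 0`. [cite: deShalit1987, Ch. I §1.7] -/
theorem ltDivPt_zero : ltDivPt hπ n 0 = 0 := by
  rw [ltDivPt, residueDigit_zero, mul_zero, map_zero, zero_ltSMul]

/-- The division points other than `ω_0` are non-zero. [cite: deShalit1987, Ch. I §1.7] -/
theorem coe_ltDivPt_ne_zero {c : 𝓀[F]} (hc : c ≠ 0) :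
    ((ltDivPt hπ n c : (maxNilIdeal F (ltField π n)).toIdeal) : unitBall (ltField π n)) ≠ 0 := by
  intro h0
  refine hc (ltDivPt_injective hπ n ?_)
  rw [ltDivPt_zero]
  exact Subtype.ext h0

/-- ★ **`W_f^1 = {0, −π}` at `q = 2`**: the non-zero `π`-division point of `f = πX + X² = X(X + π)` is `−π`
(so `K_π^1 = F`). [cite: deShalit1987, Ch. I §1.7] -/
theorem coe_ltDivPt_of_ne_zero_two (hq : residueFieldCard F = 2) {c : 𝓀[F]} (hc : c ≠ 0) :
    ((ltDivPt hπ n c : (maxNilIdeal F (ltField π n)).toIdeal) : unitBall (ltField π n)) =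
      -(algebraMap 𝒪[F] (unitBall (ltField π n)) π) := by
  have h := ltDivPt_pow_residueFieldCard hπ n c
  rw [hq, pow_two, ← neg_mul, mul_eq_mul_right_iff] at h
  exact h.resolve_right (coe_ltDivPt_ne_zero hπ n hc)

/-- `ω_1 = −π` at `q = 2`. [cite: deShalit1987, Ch. I §1.7] -/
theorem coe_ltDivPt_one_two (hq : residueFieldCard F = 2) :
    ((ltDivPt hπ n 1 : (maxNilIdeal F (ltField π n)).toIdeal) : unitBall (ltField π n)) =
      -(algebraMap 𝒪[F] (unitBall (ltField π n)) π) :=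
  coe_ltDivPt_of_ne_zero_two hπ n hq one_ne_zero

/-- `σ ∈ G(K_π^{n+1}/F)` fixes `ω_1 = −π` (it is `F`-rational). [cite: deShalit1987, Ch. I §1.7] -/
theorem mapPt_ltDivPt_one_two (hq : residueFieldCard F = 2) (σ : ltField π n ≃ₐ[F] ltField π n) :
    mapPt σ (ltDivPt hπ n 1) = ltDivPt hπ n 1 := by
  apply Subtype.ext; apply Subtype.ext
  rw [coe_mapPt, coe_ltDivPt_one_two hπ n hq, Subring.coe_neg, map_neg, algebraMap_integer_apply,
    AlgEquiv.commutes]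

/-! ### Translation by `−π` is the reflection `X ↦ −π − X` -/

/-- `f = πX + X^q` mapped to `𝒪_E⟦X⟧` is `C π · X + X^q`. [cite: deShalit1987, Ch. I §1.7] -/
theorem map_ltSer_eq (E : IntermediateField F (AlgebraicClosure F)) [FiniteDimensional F E] :
    (ltSer F π).map (algebraMap (LTCoeff F) (unitBall E)) =
      PowerSeries.C (algebraMap 𝒪[F] (unitBall E) π) * PowerSeries.X + PowerSeries.X ^ residueFieldCard F := by
  have e : ltSer F π = PowerSeries.C (LTCoeff.of F π) * PowerSeries.X + PowerSeries.X ^ residueFieldCard F := by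
    change ((ltPoly F π : Polynomial 𝒪[F]) : PowerSeries 𝒪[F]) = _
    rw [ltPoly, Polynomial.coe_add, Polynomial.coe_mul, Polynomial.coe_pow, Polynomial.coe_C, Polynomial.coe_X]
    rfl
  rw [e, map_add, map_mul, map_pow, PowerSeries.map_C, PowerSeries.map_X]
  rfl

/-- ★ **`X [+]_f (−π) = −π − X`** at `q = 2`: the translate of `X` by the non-zero division point, as a series
in `𝒪_{K_π^{n+1}}⟦X⟧` (both sides are roots `Z` of `Z² + πZ = f(X)` with constant term `−π ≠ 0`, and `𝒪⟦X⟧`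
is a domain). [cite: deShalit1987, Ch. I §3.12] -/
theorem coe_tPt_ltDivPt_two (hq : residueFieldCard F = 2) {c : 𝓀[F]} (hc : c ≠ 0) :
    ((tPt (maxNilIdeal F (ltField π n)) (isLTRing_LTCoeff hπ) (isLTSeries_LTCoeff π) (ltDivPt hπ n c) :
        (seriesNilIdeal (maxNilIdeal F (ltField π n))).toIdeal) : PowerSeries (unitBall (ltField π n))) =
      -PowerSeries.X - PowerSeries.C (algebraMap 𝒪[F] (unitBall (ltField π n)) π) := by
  set S := unitBall (ltField π n)
  set M := maxNilIdeal F (ltField π n)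
  set t := tPt M (isLTRing_LTCoeff hπ) (isLTSeries_LTCoeff π) (ltDivPt hπ n c) with ht
  set p : S := algebraMap 𝒪[F] S π with hp
  -- `f(t) = f(X)`
  have hft : evT M t ((ltSer F π).map (algebraMap (LTCoeff F) S)) = (ltSer F π).map (algebraMap (LTCoeff F) S) :=
    evT_tPt_map M (isLTRing_LTCoeff hπ) (isLTSeries_LTCoeff π) _ (ltSMul_ltDivPt hπ n c)
  rw [map_ltSer_eq, hq, map_add, map_mul, map_pow, evT_C, evT_X] at hft
  -- `(t - X)(t + X + π) = 0`
  have hprod : ((t : PowerSeries S) - PowerSeries.X) * ((t : PowerSeries S) + PowerSeries.X + PowerSeries.C p) = 0 := by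
    rw [← hp] at hft
    linear_combination hft
  rcases mul_eq_zero.mp hprod with h | h
  · exfalso
    have h0 := congrArg PowerSeries.constantCoeff h
    rw [map_sub, map_zero, PowerSeries.constantCoeff_X, sub_zero, ht, constantCoeff_tPt] at h0
    exact coe_ltDivPt_ne_zero hπ n hc h0
  · linear_combination h

variable {hπ n} in
/-- `(C s)(X [+] ω) = C s`, `X(X [+] ω₁) = −π − X`: the reflection on `𝒪_E⟦X⟧` evaluated on `ι h` is the
translate `h(X [+] ω₁)`. [cite: deShalit1987, Ch. I §3.12] -/
theorem evT_tPt_map_eq_transl (c : 𝓀[F]) (h : PowerSeries (LTCoeff F)) :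
    evT (maxNilIdeal F (ltField π n)) (tPt (maxNilIdeal F (ltField π n)) (isLTRing_LTCoeff hπ)
        (isLTSeries_LTCoeff π) (ltDivPt hπ n c)) (h.map (algebraMap (LTCoeff F) (unitBall (ltField π n)))) =
      transl (maxNilIdeal F (ltField π n)) (isLTRing_LTCoeff hπ) (isLTSeries_LTCoeff π) (ltDivPt hπ n c) h := by
  rw [evT_map]; rfl

/-- Translation by `ω_0 = 0` is the identity: `h(X [+] 0) = ι h`. [cite: deShalit1987, Ch. I §3.12] -/
theorem transl_ltDivPt_zero (h : PowerSeries (LTCoeff F)) :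
    transl (maxNilIdeal F (ltField π n)) (isLTRing_LTCoeff hπ) (isLTSeries_LTCoeff π) (ltDivPt hπ n 0) h =
      h.map (algebraMap (LTCoeff F) (unitBall (ltField π n))) := by
  rw [ltDivPt_zero, transl, tPt, serC_zero, ltAdd_zero, evalAt_serX]

/-! ### The reflection `h ↦ h(−π − X)` on `𝒪[F]⟦X⟧` -/

/-- `σ` fixes the translate `h(X [+] ω₁)` (`ω₁ = −π` is rational). [cite: deShalit1987, Ch. I §3.12] -/
theorem seriesGalMap_transl_ltDivPt_one (hq : residueFieldCard F = 2) (σ : ltField π n ≃ₐ[F] ltField π n)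
    (h : PowerSeries (LTCoeff F)) :
    seriesGalMap σ (transl (maxNilIdeal F (ltField π n)) (isLTRing_LTCoeff hπ) (isLTSeries_LTCoeff π)
        (ltDivPt hπ n 1) h) =
      transl (maxNilIdeal F (ltField π n)) (isLTRing_LTCoeff hπ) (isLTSeries_LTCoeff π) (ltDivPt hπ n 1) h := by
  rw [seriesGalMap_transl, mapPt_ltDivPt_one_two hπ n hq]

/-- **`reflTwo hπ n h = h(−π − X) ∈ 𝒪[F]⟦X⟧`** (`q = 2`): the translate `h(X [+] ω₁)` by the non-zero
`π`-division point `ω₁ = −π`, descended from `𝒪_{K_π^{n+1}}⟦X⟧` to `𝒪[F]⟦X⟧` (its coefficients are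
`G(K_π^{n+1}/F)`-fixed).  For `q ≠ 2` this is still the descent of some translate and carries no meaning.
[cite: deShalit1987, Ch. I §3.12] -/
def reflTwo (h : PowerSeries (LTCoeff F)) : PowerSeries (LTCoeff F) :=
  haveI := isGalois_ltField hπ n
  haveI := Classical.dec (residueFieldCard F = 2)
  if hq : residueFieldCard F = 2 then
    PowerSeries.mk fun k => LTCoeff.of F (exists_algebraMap_eq_of_fixed (E := ltField π n)
      (s := PowerSeries.coeff k (transl (maxNilIdeal F (ltField π n)) (isLTRing_LTCoeff hπ)
        (isLTSeries_LTCoeff π) (ltDivPt hπ n 1) h)) (fun σ => by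
        rw [← coeff_seriesGalMap, seriesGalMap_transl_ltDivPt_one hπ n hq])).choose
  else h

/-- ★ `ι(reflTwo h) = h(X [+] ω₁)` in `𝒪_{K_π^{n+1}}⟦X⟧`. [cite: deShalit1987, Ch. I §3.12] -/
theorem map_reflTwo (hq : residueFieldCard F = 2) (h : PowerSeries (LTCoeff F)) :
    (reflTwo hπ n h).map (algebraMap (LTCoeff F) (unitBall (ltField π n))) =
      transl (maxNilIdeal F (ltField π n)) (isLTRing_LTCoeff hπ) (isLTSeries_LTCoeff π) (ltDivPt hπ n 1) h := by
  haveI := isGalois_ltField hπ n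
  refine PowerSeries.ext fun k => ?_
  rw [PowerSeries.coeff_map, reflTwo, dif_pos hq, PowerSeries.coeff_mk]
  exact (exists_algebraMap_eq_of_fixed (E := ltField π n)
    (s := PowerSeries.coeff k (transl (maxNilIdeal F (ltField π n)) (isLTRing_LTCoeff hπ)
      (isLTSeries_LTCoeff π) (ltDivPt hπ n 1) h)) (fun σ => by
      rw [← coeff_seriesGalMap, seriesGalMap_transl_ltDivPt_one hπ n hq])).choose_spec

/-- `ι(reflTwo h) = (ι h)(X [+] ω₁)` (reflection as the `𝒪_E`-algebra endomorphism `evT`).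
[cite: deShalit1987, Ch. I §3.12] -/
theorem map_reflTwo_eq_evT (hq : residueFieldCard F = 2) (h : PowerSeries (LTCoeff F)) :
    (reflTwo hπ n h).map (algebraMap (LTCoeff F) (unitBall (ltField π n))) =
      evT (maxNilIdeal F (ltField π n)) (tPt (maxNilIdeal F (ltField π n)) (isLTRing_LTCoeff hπ)
        (isLTSeries_LTCoeff π) (ltDivPt hπ n 1)) (h.map (algebraMap (LTCoeff F) (unitBall (ltField π n)))) := by
  rw [map_reflTwo hπ n hq, evT_tPt_map_eq_transl]

/-- `reflTwo` is additive. [cite: deShalit1987, Ch. I §3.12] -/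
theorem reflTwo_add (hq : residueFieldCard F = 2) (h h' : PowerSeries (LTCoeff F)) :
    reflTwo hπ n (h + h') = reflTwo hπ n h + reflTwo hπ n h' := by
  refine PowerSeries.map_injective _ (algebraMap_LTCoeff_injective (ltField π n)) ?_
  rw [map_add, map_reflTwo_eq_evT hπ n hq, map_reflTwo_eq_evT hπ n hq, map_reflTwo_eq_evT hπ n hq, map_add,
    map_add]

/-- `reflTwo` is multiplicative. [cite: deShalit1987, Ch. I §3.12] -/
theorem reflTwo_mul (hq : residueFieldCard F = 2) (h h' : PowerSeries (LTCoeff F)) :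
    reflTwo hπ n (h * h') = reflTwo hπ n h * reflTwo hπ n h' := by
  refine PowerSeries.map_injective _ (algebraMap_LTCoeff_injective (ltField π n)) ?_
  rw [map_mul, map_reflTwo_eq_evT hπ n hq, map_reflTwo_eq_evT hπ n hq, map_reflTwo_eq_evT hπ n hq, map_mul,
    map_mul]

/-- `reflTwo` on differences. [cite: deShalit1987, Ch. I §3.12] -/
theorem reflTwo_sub (hq : residueFieldCard F = 2) (h h' : PowerSeries (LTCoeff F)) :
    reflTwo hπ n (h - h') = reflTwo hπ n h - reflTwo hπ n h' := by
  refine PowerSeries.map_injective _ (algebraMap_LTCoeff_injective (ltField π n)) ?_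
  rw [map_sub, map_reflTwo_eq_evT hπ n hq, map_reflTwo_eq_evT hπ n hq, map_reflTwo_eq_evT hπ n hq, map_sub,
    map_sub]

/-- `reflTwo (C a) = C a`. [cite: deShalit1987, Ch. I §3.12] -/
theorem reflTwo_C (hq : residueFieldCard F = 2) (a : LTCoeff F) :
    reflTwo hπ n (PowerSeries.C a) = PowerSeries.C a := by
  refine PowerSeries.map_injective _ (algebraMap_LTCoeff_injective (ltField π n)) ?_
  rw [map_reflTwo_eq_evT hπ n hq, PowerSeries.map_C, evT_C]

/-- ★ **`reflTwo X = −π − X`.** [cite: deShalit1987, Ch. I §3.12] -/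
theorem reflTwo_X (hq : residueFieldCard F = 2) :
    reflTwo hπ n PowerSeries.X = -PowerSeries.X - PowerSeries.C (LTCoeff.of F π) := by
  refine PowerSeries.map_injective _ (algebraMap_LTCoeff_injective (ltField π n)) ?_
  rw [map_reflTwo_eq_evT hπ n hq, PowerSeries.map_X, evT_X, coe_tPt_ltDivPt_two hπ n hq one_ne_zero, map_sub,
    map_neg, PowerSeries.map_X, PowerSeries.map_C]
  rfl

/-- `reflTwo (C a · h) = C a · reflTwo h` (`𝒪[F]`-linearity). [cite: deShalit1987, Ch. I §3.12] -/
theorem reflTwo_C_mul (hq : residueFieldCard F = 2) (a : LTCoeff F) (h : PowerSeries (LTCoeff F)) :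
    reflTwo hπ n (PowerSeries.C a * h) = PowerSeries.C a * reflTwo hπ n h := by
  rw [reflTwo_mul hπ n hq, reflTwo_C hπ n hq]

/-- ★ **`reflTwo` is an involution**: `(h(−π − X))(−π − X) = h` (`ω₁ [+] ω₁ = ω_{1+1} = ω_0 = 0`).
[cite: deShalit1987, Ch. I §3.12] -/
theorem reflTwo_reflTwo (hq : residueFieldCard F = 2) (h : PowerSeries (LTCoeff F)) :
    reflTwo hπ n (reflTwo hπ n h) = h := by
  haveI := charP_two_of_residueFieldCard (F := F) hq
  refine PowerSeries.map_injective _ (algebraMap_LTCoeff_injective (ltField π n)) ?_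
  rw [map_reflTwo_eq_evT hπ n hq, map_reflTwo hπ n hq, evT_transl, ltAdd_ltDivPt,
    show (1 : 𝓀[F]) + 1 = 0 from CharTwo.add_self_eq_zero 1, transl_ltDivPt_zero]

/-- **`(r ∘ f)(X [+] ω) = r ∘ f` for every `π`-division point `ω`** (`f(X [+] ω) = f(X) [+] [π]ω = f(X)`): the
series in `f` are translation invariant (any `q`). [cite: deShalit1987, Ch. I §3.12] -/
theorem transl_ltDivPt_subst_ltSer (c : 𝓀[F]) (r : PowerSeries (LTCoeff F)) :
    transl (maxNilIdeal F (ltField π n)) (isLTRing_LTCoeff hπ) (isLTSeries_LTCoeff π) (ltDivPt hπ n c)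
        (PowerSeries.subst (ltSer F π) r) =
      PowerSeries.map (algebraMap (LTCoeff F) (unitBall (ltField π n))) (PowerSeries.subst (ltSer F π) r) := by
  set S := unitBall (ltField π n)
  set M := maxNilIdeal F (ltField π n)
  -- both sides are `r` evaluated at the point `f(X [+] ω) = f(X)` of `𝒪_E⟦X⟧`
  have key : ∀ t : (seriesNilIdeal M).toIdeal,
      evalAt (seriesNilIdeal M) t (PowerSeries.subst (ltSer F π) r) =
        evalAt (seriesNilIdeal M) (ltSMul (seriesNilIdeal M) (isLTRing_LTCoeff hπ) (isLTSeries_LTCoeff π)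
          (LTCoeff.of F π) t) r := by
    intro t
    rw [evalAt_apply, evalAt_apply, PowerSeries.aeval, PowerSeries.aeval, PowerSeries.subst]
    refine aeval_subst (a := fun _ : Unit => (ltSer F π)) (MvPowerSeries.hasSubst_of_constantCoeff_zero
      fun _ => (isLTSeries_ltSer π).constantCoeff_eq_zero) _ _ _ fun _ => ?_
    rw [coe_ltSMul_eq_evalAt]
    rfl
  rw [transl, key, ← evalAt_serX M, key, tPt, ltSMul_ltAdd, ← serC_ltSMul, ltSMul_ltDivPt, serC_zero, ltAdd_zero]

/-- ★ **`reflTwo` fixes `𝒪[F]⟦f⟧`**: `(r ∘ f)(−π − X) = r ∘ f` (`f(−π − X) = f(X)`).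
[cite: deShalit1987, Ch. I §3.12] -/
theorem reflTwo_subst_ltSer (hq : residueFieldCard F = 2) (r : PowerSeries (LTCoeff F)) :
    reflTwo hπ n (PowerSeries.subst (ltSer F π) r) = PowerSeries.subst (ltSer F π) r :=
  PowerSeries.map_injective _ (algebraMap_LTCoeff_injective (ltField π n))
    ((map_reflTwo hπ n hq _).trans (transl_ltDivPt_subst_ltSer hπ n 1 r))

/-- ★ **`h − h(−π − X) ≡ 0 (mod π)`** for every `h ∈ 𝒪[F]⟦X⟧` (`X [+] ω₁ ≡ X` modulo the closed ideal `𝔪_E ∋ ω₁`,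
then descent of the congruence to `𝒪[F]`). [cite: deShalit1987, Ch. I §3.12] -/
theorem sub_reflTwo_mem_coeffIdeal (hq : residueFieldCard F = 2) (h : PowerSeries (LTCoeff F)) :
    h - reflTwo hπ n h ∈ coeffIdeal (Ideal.span {LTCoeff.of F π}) := by
  refine mem_coeffIdeal_of_map_mem hπ (E := ltField π n) ?_
  rw [map_sub, map_reflTwo hπ n hq, ← neg_sub]
  exact Submodule.neg_mem _ (transl_sub_map_mem_coeffIdeal (maxNilIdeal F (ltField π n)) (isLTRing_LTCoeff hπ)
    (isLTSeries_LTCoeff π) (maxNilIdeal F (ltField π n)).toIdeal (maxNilIdeal F (ltField π n)).isClosed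
    (ltDivPt hπ n 1) (ltDivPt hπ n 1).2 h)

end LocalFieldR2

end Literature.NumberTheory.GaloisRepresentations
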